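import Literature.Analysis.FluidPDE.HardSphereCollisionRecord
import Literature.MathematicalPhysics.KineticTheory.HardSphereWindowPressureStatic
import Summits.AtomisticToContinuum.HydrodynamicLimit.Theorems.TwoClocksEquilibriumShearWindowLDStatic
import Summits.AtomisticToContinuum.HydrodynamicLimit.Theorems.TwoClocksEquilibriumShearWindowLDWindows

/-!
# Energy-weight truncation for the clamp census `D₃` of the line `birth`
(crux `TwoClocks.EquilibriumFastWindowLD`, stmt-AtomisticToContinuum-14440; skeleton `Lines/birth.lean` rev 3,
stub `stub_activityCensus`)

Support file (`--supports stmt-AtomisticToContinuum-14440`), two registered helper sub-goals of the stub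
`stub_activityCensus` (D₃ = the equilibrium census pricing the end-of-window clamp: particles switched off —
window activity `> V` or window collision count `> Vτ` — weighted by `1 + w⁻¹∫₀ʷ‖vᵢ‖²`, per-particle pressure
`≤ ε` under the invariant Gibbs law as `τ → ∞` at fixed `V`). Both are STATICS; the stub itself contains the
tagged-particle window large-deviation census under the deterministic equilibrium dynamics and is not proved here.

* `d3_census_truncation` — quantitative, every window `w > 0`, every `N`, arbitrary weights `oᵢ ∈ [0, 1]`
  (no measurability of the weights is needed): for `σ ≤ 1/2`, `0 ≤ β`, `16βθ₀ < 1` and every level `Q`,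
  `∫⁻ e^{β Σᵢ oᵢ(1+Kᵢ)} dG_N ≤ ½ ∫⁻ e^{2β Σᵢ oᵢ(1+min(Kᵢ,Q))} dG_N + ½ (1 + e^{-4βQ}e^{8β‖u₀‖²}(1-16βθ₀)^{-3/2})^{N+1}`,
  `Kᵢ = w⁻¹∫₀ʷ‖vᵢ(r)‖² dr`. Ingredients: on good orbits `oᵢ(1+Kᵢ) ≤ oᵢ(1+min(Kᵢ,Q)) + w⁻¹∫₀ʷ(‖vᵢ‖²-Q)₊`
  (positivity of the positive part), `e^{a+b} ≤ ½e^{2a} + ½e^{2b}`, Jensen in time + invariance of `G_N`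
  for the continuous one-body observable `(‖v‖²-Q)₊` (`lintegral_exp_windowSum_le_static`), one-site Gaussian
  factorisation (`lintegral_exp_sum_localGibbsMeasure_const_le`) with the Chernoff bound
  `e^{2β(s-Q)₊} ≤ 1 + e^{-4βQ}e^{4βs}` and `∫ e^{4β‖v‖²} dN(u₀,θ₀) ≤ e^{8β‖u₀‖²}(1-16βθ₀)^{-3/2}`.
* `d3_census_of_truncatedCensus` — the registered statement of `stub_activityCensus` FOLLOWS from its
  bounded-weight version (same statement with `1 + min(w⁻¹∫₀ʷ‖vᵢ‖², Q)`, `∀ Q ≥ 0` inserted after the tilt,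
  `τ₀` allowed to depend on `Q`), with `σ₀ ↦ min(σ₀, 1/2)`, `β₁ ↦ min(β₁/2, 1/(32θ₀))`.

Why this is the right cut (worker's audit of D₃). Since `N → ∞` after `τ`, every MACROSCOPIC density /
temperature profile is quasi-static over the window, and a region compressed by `λ` and heated by `t` has its
collision-count rate raised by `λ√t·Y(λφ₀)/Y(φ₀)` at the finite, `τ`-independent Gibbs cost
`c = Δf(λ) + (3/2)(t-1-log t)` per member (Carnahan–Starling numbers at `σ = 0.3`, `θ₀ = 1`, `Γ₀ = 4√π Y σ²√θ₀`
the mean count per unit `τ`: reaching `V/Γ₀ = 2, 10, 100` costs `c ≈ 0.18, 1.5, 5.0`). Hence (i) the energy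
weights cannot be split off into an UNWEIGHTED census at a large coupling: `∫⁻ e^{M·#off} dG_N ≤ e^{ε(N+1)}`
fails for `M > c(V/Γ₀)` at every `τ`, while Hölder-splitting the weights needs `M = β(1+Q(ε)) → ∞` — the
truncated weight must stay inside the census, as above (hot regions then pay `(3/2)(t-1-log t) > 3βθ₀t` for
`β < 1/(2θ₀)`, `t` large); (ii) the order `∃ V₀ ∃ β₁ ∀ V ≥ V₀` of D₃ is load-bearing: already the exact
global-heating tilt (an invariant event, no equation of state) gives pressure `≥ β(1+3θ₀t) - (3/2)(t-1-log t)`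
at `t = (V/Γ₀)²` granted the count LLN, so (`θ₀ = 1`) `V₀/Γ₀ ≥ 2.42` is forced at `β₁ = 1/4`, `≥ 1.34` at
`β₁ = 0.05`, `≥ 1 + √(β₁(1+3θ₀)/3)` as `β₁ → 0`; with compression `V₀/Γ₀ ≳ 12` at `β₁ = 1/4`. The L¹ activity
tails of the route (`TwoClocks.TransferActivityTails`) are insufficient for D₃ on two counts: L¹ instead of
exponential scale, and no clause for the collision COUNT (thermal kicks `≈ 1.8√θ₀ < 1/σ`: `act ≤ V` allows
`cnt > Vτ`). Microscopic near-contact cages are NOT a `τ`-independent source of off particles: an isolated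
cluster of `k` spheres makes `≤ K(k) < ∞` collisions in free flight (Burago–Ferleger–Kononenko 1998), so
`Vτ → ∞` collisions need `≳ Vτ/K(k)` re-compressions by the gas — the dynamical LLN event itself.
prover-line-stmt-AtomisticToContinuum-14440-a1-0 (stub-worker D₃), 2026-08-17.
-/

noncomputable section

open MeasureTheory
open scoped ENNReal BigOperators

namespace Summit.AtomisticToContinuum.HydrodynamicLimit.Theorems.ClampedCorrectorBirth

open Literature.Analysis.FluidPDE Literature.MathematicalPhysics.KineticTheory

/-- Pointwise truncation of the exponential weight: for `0 ≤ β`,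
`exp(2β (s - Q)₊) ≤ 1 + exp(-4βQ) · exp(8β · s/2)`. -/
private theorem exp_two_mul_posPart_le {β : ℝ} (hβ : 0 ≤ β) (s Q : ℝ) :
    Real.exp (2 * β * max (s - Q) 0) ≤
      1 + Real.exp (-(4 * β * Q)) * Real.exp (8 * β * (s / 2)) := by
  have hprod : 0 ≤ Real.exp (-(4 * β * Q)) * Real.exp (8 * β * (s / 2)) := by positivity
  rcases le_or_gt (s - Q) 0 with h | h
  · rw [max_eq_right h, mul_zero, Real.exp_zero]
    linarith
  · rw [max_eq_left h.le, ← Real.exp_add]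
    have h1 : Real.exp (2 * β * (s - Q)) ≤ Real.exp (-(4 * β * Q) + 8 * β * (s / 2)) :=
      Real.exp_le_exp.2 (by nlinarith)
    linarith [Real.exp_pos (-(4 * β * Q) + 8 * β * (s / 2))]

/-- The velocity space `V3 = ℝ³` has dimension `3`. -/
private theorem finrank_V3 : (Module.finrank ℝ V3 : ℝ) = 3 := by
  rw [finrank_euclideanSpace_fin]
  norm_num

/-- One-site Gaussian bound for the truncated energy weight: for `θ₀ > 0`, `0 ≤ β`, `16βθ₀ < 1`,
`∫ exp(2β (‖v‖² - Q)₊) N(u₀, θ₀)(dv) ≤ 1 + exp(-4βQ) · exp(8β‖u₀‖²) (1 - 16βθ₀)^{-3/2}`. -/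
private theorem oneSite_posPart_le {θ₀ : ℝ} (hθ : 0 < θ₀) (u₀ : V3) {β : ℝ} (hβ : 0 ≤ β)
    (hβθ : 16 * β * θ₀ < 1) (Q : ℝ) (x : T3) :
    ∫⁻ v, ENNReal.ofReal (Real.exp (2 * β * max (‖(x, v).2‖ ^ 2 - Q) 0)) ∂(gaussMeasure u₀ θ₀) ≤
      ENNReal.ofReal (1 + Real.exp (-(4 * β * Q)) *
        (Real.exp (8 * β * ‖u₀‖ ^ 2) * (1 - 16 * β * θ₀) ^ (-(3 : ℝ) / 2))) := by
  have hγ : 0 ≤ 8 * β := by positivity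
  have hs : 2 * (8 * β) * θ₀ < 1 := by linarith
  set M : ℝ := Real.exp (8 * β * ‖u₀‖ ^ 2) * (1 - 16 * β * θ₀) ^ (-(3 : ℝ) / 2) with hM
  have hM0 : 0 ≤ M := mul_nonneg (Real.exp_nonneg _) (Real.rpow_nonneg (by linarith) _)
  have hG : ∫⁻ v, ENNReal.ofReal (Real.exp (8 * β * (‖v‖ ^ 2 / 2))) ∂(gaussMeasure u₀ θ₀) ≤
      ENNReal.ofReal M := by
    have h := lintegral_exp_mul_norm_sq_gaussMeasure_le hθ hγ hs u₀
    have hEq : Real.exp (8 * β * ‖u₀‖ ^ 2) *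
        (1 - 2 * (8 * β) * θ₀) ^ (-(Module.finrank ℝ V3 : ℝ) / 2) = M := by
      rw [finrank_V3, hM]
      congr 2
      ring
    rw [hEq] at h
    exact h
  calc ∫⁻ v, ENNReal.ofReal (Real.exp (2 * β * max (‖(x, v).2‖ ^ 2 - Q) 0)) ∂(gaussMeasure u₀ θ₀)
      ≤ ∫⁻ v, (1 + ENNReal.ofReal (Real.exp (-(4 * β * Q))) *
          ENNReal.ofReal (Real.exp (8 * β * (‖v‖ ^ 2 / 2)))) ∂(gaussMeasure u₀ θ₀) := by
        refine lintegral_mono fun v => ?_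
        calc ENNReal.ofReal (Real.exp (2 * β * max (‖(x, v).2‖ ^ 2 - Q) 0))
            ≤ ENNReal.ofReal (1 + Real.exp (-(4 * β * Q)) * Real.exp (8 * β * (‖v‖ ^ 2 / 2))) :=
              ENNReal.ofReal_le_ofReal (exp_two_mul_posPart_le hβ _ _)
          _ = 1 + ENNReal.ofReal (Real.exp (-(4 * β * Q))) *
              ENNReal.ofReal (Real.exp (8 * β * (‖v‖ ^ 2 / 2))) := by
              rw [ENNReal.ofReal_add zero_le_one (by positivity), ENNReal.ofReal_one,
                ENNReal.ofReal_mul (Real.exp_nonneg _)]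
    _ = 1 + ENNReal.ofReal (Real.exp (-(4 * β * Q))) *
          ∫⁻ v, ENNReal.ofReal (Real.exp (8 * β * (‖v‖ ^ 2 / 2))) ∂(gaussMeasure u₀ θ₀) := by
        rw [lintegral_add_left measurable_const, lintegral_const, measure_univ, mul_one,
          lintegral_const_mul' _ _ ENNReal.ofReal_ne_top]
    _ ≤ 1 + ENNReal.ofReal (Real.exp (-(4 * β * Q))) * ENNReal.ofReal M := by
        gcongr
    _ = ENNReal.ofReal (1 + Real.exp (-(4 * β * Q)) * M) := by
        rw [← ENNReal.ofReal_mul (Real.exp_nonneg _), ← ENNReal.ofReal_one,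
          ← ENNReal.ofReal_add zero_le_one (mul_nonneg (Real.exp_nonneg _) hM0)]

/-- **Energy-weight truncation of the clamp census (quantitative, every window).** Under the
homogeneous Gibbs law `G_N = localGibbsLaw σ a₀ u₀ θ₀ N Φ` (`σ ≤ 1/2`, `a₀, θ₀ > 0`), for ANY weights
`o i z ∈ [0, 1]` (no measurability needed; the census takes `o = off`, the end-of-window clamp
indicator), every window `w > 0`, `0 ≤ β` with `16βθ₀ < 1` and every truncation level `Q`:
`∫⁻ exp(β Σᵢ oᵢ (1 + Kᵢ)) dG_N ≤ ½ ∫⁻ exp(2β Σᵢ oᵢ (1 + min(Kᵢ, Q))) dG_N + ½ (1 + e^{-4βQ} e^{8β‖u₀‖²}(1-16βθ₀)^{-3/2})^{N+1}`,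
`Kᵢ = w⁻¹∫₀ʷ ‖vᵢ(r)‖² dr` the window-averaged kinetic energy. Proof: on good orbits
`oᵢ(1 + Kᵢ) ≤ oᵢ(1 + min(Kᵢ,Q)) + w⁻¹∫₀ʷ (‖vᵢ(r)‖² - Q)₊ dr` (positivity of the positive part, no
Jensen), `e^{a+b} ≤ ½e^{2a} + ½e^{2b}`, and the second window functional is a continuous one-body
observable: Jensen in time + invariance (`lintegral_exp_windowSum_le_static`) and the one-site Gaussian
factorisation (`lintegral_exp_sum_localGibbsMeasure_const_le`) with the Chernoff bound
`e^{2β(s-Q)₊} ≤ 1 + e^{-4βQ}e^{4βs}`. -/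
theorem d3_census_truncation :
    ∀ (a₀ θ₀ : ℝ) (u₀ : V3), 0 < a₀ → 0 < θ₀ → ∀ σ : ℝ, σ ≤ 1 / 2 →
    ∀ (N : ℕ) (Φ : HardSphereFlow (Torus.geometry (Fin 3)) (hsDiameter σ N) (N + 1))
      (o : Fin (N + 1) → Config (N + 1) (Fin 3) T3 → ℝ),
      (∀ i z, 0 ≤ o i z) → (∀ i z, o i z ≤ 1) →
    ∀ (w β Q : ℝ), 0 < w → 0 ≤ β → 16 * β * θ₀ < 1 →
      ∫⁻ z, ENNReal.ofReal (Real.exp (β * ∑ i : Fin (N + 1),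
          o i z * (1 + w⁻¹ * ∫ r in (0 : ℝ)..w, ‖(Φ.flow r z i).2‖ ^ 2)))
        ∂(localGibbsLaw σ (fun _ => a₀) (fun _ => u₀) (fun _ => θ₀) N Φ) ≤
      2⁻¹ * ∫⁻ z, ENNReal.ofReal (Real.exp (2 * β * ∑ i : Fin (N + 1),
          o i z * (1 + min (w⁻¹ * ∫ r in (0 : ℝ)..w, ‖(Φ.flow r z i).2‖ ^ 2) Q)))
        ∂(localGibbsLaw σ (fun _ => a₀) (fun _ => u₀) (fun _ => θ₀) N Φ) +
      2⁻¹ * ENNReal.ofReal ((1 + Real.exp (-(4 * β * Q)) *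
          (Real.exp (8 * β * ‖u₀‖ ^ 2) * (1 - 16 * β * θ₀) ^ (-(3 : ℝ) / 2))) ^ (N + 1)) := by
  intro a₀ θ₀ u₀ ha hθ σ hσ2 N Φ o ho0 ho1 w β Q hw hβ hβθ
  set μ := localGibbsLaw σ (fun _ => a₀) (fun _ => u₀) (fun _ => θ₀) N Φ with hμdef
  have hμ : μ Φ.goodᶜ = 0 := localGibbsLaw_const_compl_good σ a₀ θ₀ u₀ N Φ
  -- the truncated-tail one-body observable `(‖v‖² - Q)₊`
  set FQ : T3 × V3 → ℝ := fun y => max (‖y.2‖ ^ 2 - Q) 0 with hFQ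
  have hFQc : Continuous FQ := by
    simp only [hFQ]
    fun_prop
  -- the two functionals of the split
  set A : Config (N + 1) (Fin 3) T3 → ℝ := fun z =>
    ∑ i, o i z * (1 + min (w⁻¹ * ∫ r in (0 : ℝ)..w, ‖(Φ.flow r z i).2‖ ^ 2) Q) with hA
  set B : Config (N + 1) (Fin 3) T3 → ℝ := fun z =>
    ∑ i, w⁻¹ * ∫ r in (0 : ℝ)..w, FQ (Φ.flow r z i) with hB
  -- pathwise split on the good set
  have hpath : ∀ z ∈ Φ.good,
      ∑ i, o i z * (1 + w⁻¹ * ∫ r in (0 : ℝ)..w, ‖(Φ.flow r z i).2‖ ^ 2) ≤ A z + B z := by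
    intro z hz
    simp only [hA, hB, ← Finset.sum_add_distrib]
    refine Finset.sum_le_sum fun i _ => ?_
    have hI1 : IntervalIntegrable (fun r => ‖(Φ.flow r z i).2‖ ^ 2) volume 0 w :=
      Φ.intervalIntegrable_comp_flow_of_continuous hz
        (F := fun c : Config (N + 1) (Fin 3) T3 => ‖(c i).2‖ ^ 2) (by fun_prop) 0 w
    have hI2 : IntervalIntegrable (fun r => FQ (Φ.flow r z i)) volume 0 w :=
      Φ.intervalIntegrable_comp_flow_of_continuous hz
        (F := fun c : Config (N + 1) (Fin 3) T3 => FQ (c i)) (hFQc.comp (continuous_apply i)) 0 w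
    have hBi0 : 0 ≤ w⁻¹ * ∫ r in (0 : ℝ)..w, FQ (Φ.flow r z i) :=
      mul_nonneg (inv_nonneg.2 hw.le)
        (intervalIntegral.integral_nonneg hw.le fun r _ => le_max_right _ _)
    have hKQ : w⁻¹ * (∫ r in (0 : ℝ)..w, ‖(Φ.flow r z i).2‖ ^ 2) - Q ≤
        w⁻¹ * ∫ r in (0 : ℝ)..w, FQ (Φ.flow r z i) := by
      have h1 : ∫ r in (0 : ℝ)..w, (‖(Φ.flow r z i).2‖ ^ 2 - Q) =
          (∫ r in (0 : ℝ)..w, ‖(Φ.flow r z i).2‖ ^ 2) - w * Q := by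
        rw [intervalIntegral.integral_sub hI1 intervalIntegrable_const,
          intervalIntegral.integral_const, sub_zero, smul_eq_mul]
      have h2 : ∫ r in (0 : ℝ)..w, (‖(Φ.flow r z i).2‖ ^ 2 - Q) ≤
          ∫ r in (0 : ℝ)..w, FQ (Φ.flow r z i) :=
        intervalIntegral.integral_mono_on hw.le (hI1.sub intervalIntegrable_const) hI2
          fun r _ => le_max_left _ _
      have h3 : w⁻¹ * (∫ r in (0 : ℝ)..w, ‖(Φ.flow r z i).2‖ ^ 2) - Q =
          w⁻¹ * ∫ r in (0 : ℝ)..w, (‖(Φ.flow r z i).2‖ ^ 2 - Q) := by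
        rw [h1, mul_sub, ← mul_assoc, inv_mul_cancel₀ hw.ne', one_mul]
      rw [h3]
      exact mul_le_mul_of_nonneg_left h2 (inv_nonneg.2 hw.le)
    have ho0' := ho0 i z
    have ho1' := ho1 i z
    rcases le_total (w⁻¹ * ∫ r in (0 : ℝ)..w, ‖(Φ.flow r z i).2‖ ^ 2) Q with hle | hle
    · rw [min_eq_left hle]
      linarith
    · rw [min_eq_right hle]
      nlinarith
  -- pointwise a.e.: `e^{βS} ≤ ½ e^{2βA} + ½ e^{2βB}`
  have hgood : ∀ᵐ z ∂μ, z ∈ Φ.good :=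
    (measure_eq_zero_iff_ae_notMem.1 hμ).mono fun z hz => by simpa using hz
  have hae : ∀ᵐ z ∂μ,
      ENNReal.ofReal (Real.exp (β * ∑ i : Fin (N + 1),
          o i z * (1 + w⁻¹ * ∫ r in (0 : ℝ)..w, ‖(Φ.flow r z i).2‖ ^ 2))) ≤
        2⁻¹ * ENNReal.ofReal (Real.exp (2 * β * A z)) +
          2⁻¹ * ENNReal.ofReal (Real.exp (2 * β * B z)) := by
    filter_upwards [hgood] with z hz
    have h1 : Real.exp (β * ∑ i : Fin (N + 1),
        o i z * (1 + w⁻¹ * ∫ r in (0 : ℝ)..w, ‖(Φ.flow r z i).2‖ ^ 2)) ≤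
        Real.exp (β * A z) * Real.exp (β * B z) := by
      rw [← Real.exp_add]
      exact Real.exp_le_exp.2 (by nlinarith [hpath z hz])
    have h2 : Real.exp (β * A z) * Real.exp (β * B z) ≤
        2⁻¹ * Real.exp (2 * β * A z) + 2⁻¹ * Real.exp (2 * β * B z) := by
      have h := two_mul_le_add_sq (Real.exp (β * A z)) (Real.exp (β * B z))
      rw [← Real.exp_nat_mul, ← Real.exp_nat_mul] at h
      push_cast at h
      have e1 : (2 : ℝ) * (β * A z) = 2 * β * A z := by ring
      have e2 : (2 : ℝ) * (β * B z) = 2 * β * B z := by ring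
      rw [e1, e2] at h
      linarith
    calc ENNReal.ofReal (Real.exp (β * ∑ i : Fin (N + 1),
          o i z * (1 + w⁻¹ * ∫ r in (0 : ℝ)..w, ‖(Φ.flow r z i).2‖ ^ 2)))
        ≤ ENNReal.ofReal (2⁻¹ * Real.exp (2 * β * A z) + 2⁻¹ * Real.exp (2 * β * B z)) :=
          ENNReal.ofReal_le_ofReal (h1.trans h2)
      _ = 2⁻¹ * ENNReal.ofReal (Real.exp (2 * β * A z)) +
          2⁻¹ * ENNReal.ofReal (Real.exp (2 * β * B z)) := by
          rw [ENNReal.ofReal_add (by positivity) (by positivity),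
            ENNReal.ofReal_mul (by norm_num), ENNReal.ofReal_mul (by norm_num),
            ENNReal.ofReal_inv_of_pos two_pos, ENNReal.ofReal_ofNat]
  -- the `B`-part is a.e.-measurable (window functional of a continuous observable)
  have hBm : AEMeasurable (fun z => 2⁻¹ * ENNReal.ofReal (Real.exp (2 * β * B z))) μ :=
    (Real.measurable_exp.comp_aemeasurable
      (aemeasurable_windowSum Φ hμ hFQc (2 * β) w)).ennreal_ofReal.const_mul _
  -- the `B`-part: Jensen in time + invariance, then one-site Gaussian factorisation
  have hBbound : ∫⁻ z, ENNReal.ofReal (Real.exp (2 * β * B z)) ∂μ ≤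
      ENNReal.ofReal ((1 + Real.exp (-(4 * β * Q)) *
          (Real.exp (8 * β * ‖u₀‖ ^ 2) * (1 - 16 * β * θ₀) ^ (-(3 : ℝ) / 2))) ^ (N + 1)) := by
    refine (lintegral_exp_windowSum_le_static σ a₀ θ₀ u₀ N Φ hFQc (2 * β) hw).trans ?_
    have hq : Measurable fun y : T3 × V3 => 2 * β * FQ y := hFQc.measurable.const_mul _
    have hone := oneSite_posPart_le hθ u₀ hβ hβθ Q
    have h2 := lintegral_exp_sum_localGibbsMeasure_const_le ha hθ u₀ hσ2 N hq hone
    have hpos : 0 ≤ 1 + Real.exp (-(4 * β * Q)) *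
        (Real.exp (8 * β * ‖u₀‖ ^ 2) * (1 - 16 * β * θ₀) ^ (-(3 : ℝ) / 2)) :=
      add_nonneg zero_le_one (mul_nonneg (Real.exp_nonneg _)
        (mul_nonneg (Real.exp_nonneg _) (Real.rpow_nonneg (by linarith) _)))
    rw [localGibbsLaw_eq, ENNReal.ofReal_pow hpos]
    refine le_trans (le_of_eq ?_) h2
    refine lintegral_congr fun z => ?_
    rw [Finset.mul_sum]
  -- assemble
  calc ∫⁻ z, ENNReal.ofReal (Real.exp (β * ∑ i : Fin (N + 1),
          o i z * (1 + w⁻¹ * ∫ r in (0 : ℝ)..w, ‖(Φ.flow r z i).2‖ ^ 2))) ∂μ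
      ≤ ∫⁻ z, (2⁻¹ * ENNReal.ofReal (Real.exp (2 * β * A z)) +
          2⁻¹ * ENNReal.ofReal (Real.exp (2 * β * B z))) ∂μ := lintegral_mono_ae hae
    _ = ∫⁻ z, 2⁻¹ * ENNReal.ofReal (Real.exp (2 * β * A z)) ∂μ +
          ∫⁻ z, 2⁻¹ * ENNReal.ofReal (Real.exp (2 * β * B z)) ∂μ := lintegral_add_right' _ hBm
    _ = 2⁻¹ * ∫⁻ z, ENNReal.ofReal (Real.exp (2 * β * A z)) ∂μ +
          2⁻¹ * ∫⁻ z, ENNReal.ofReal (Real.exp (2 * β * B z)) ∂μ := by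
        rw [lintegral_const_mul' _ _ (by simp), lintegral_const_mul' _ _ (by simp)]
    _ ≤ 2⁻¹ * ∫⁻ z, ENNReal.ofReal (Real.exp (2 * β * A z)) ∂μ +
          2⁻¹ * ENNReal.ofReal ((1 + Real.exp (-(4 * β * Q)) *
            (Real.exp (8 * β * ‖u₀‖ ^ 2) * (1 - 16 * β * θ₀) ^ (-(3 : ℝ) / 2))) ^ (N + 1)) := by
        gcongr

/-- **`D₃` reduces to its bounded-weight version.** If the clamp census holds with the energy
weights TRUNCATED at an arbitrary level `Q` (hypothesis: the statement of `stub_activityCensus` with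
`1 + min(w⁻¹∫₀ʷ‖vᵢ‖², Q)` in place of `1 + w⁻¹∫₀ʷ‖vᵢ‖²`, for every `Q ≥ 0`, the threshold `τ₀`
being allowed to depend on `Q`), then the registered census `D₃` (`stub_activityCensus`, verbatim)
holds, with `σ₀ ↦ min(σ₀, 1/2)` and `β₁ ↦ min(β₁/2, 1/(32θ₀))`: apply `d3_census_truncation` at
coupling `β` with `o = off`, feed the hypothesis at coupling `2β` and tolerance `ε/2`, and choose
`Q = Q(ε, β, θ₀, u₀)` with `e^{-4βQ}e^{8β‖u₀‖²}(1-16βθ₀)^{-3/2} ≤ ε/2`, so that the static factor is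
`≤ (1 + ε/2)^{N+1} ≤ e^{(ε/2)(N+1)}`. The dynamical content of `D₃` is therefore exactly the
exponential-scale census of the pair (clamp indicator, truncated window energy). -/
theorem d3_census_of_truncatedCensus :
    (∃ σ₀ : ℝ, 0 < σ₀ ∧ ∀ (a₀ θ₀ : ℝ) (u₀ : V3), 0 < a₀ → 0 < θ₀ → ∀ σ : ℝ, 0 < σ → σ < σ₀ →
      ∀ Φ : (N : ℕ) → HardSphereFlow (Torus.geometry (Fin 3)) (hsDiameter σ N) (N + 1),
      ∃ V₀ : ℝ, 0 < V₀ ∧ ∃ β₁ : ℝ, 0 < β₁ ∧ ∀ V : ℝ, V₀ ≤ V → ∀ β : ℝ, 0 < β → β ≤ β₁ →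
        ∀ Q : ℝ, 0 ≤ Q → ∀ ε : ℝ, 0 < ε → ∃ τ₀ : ℝ, 0 < τ₀ ∧ ∀ τ : ℝ, τ₀ ≤ τ →
          ∃ N₀ : ℕ, ∀ N : ℕ, N₀ ≤ N →
            (let w : ℝ := τ * ((N : ℝ) + 1) ^ (-(1 / 3 : ℝ))
             let P := localGibbsLaw σ (fun _ => a₀) (fun _ => u₀) (fun _ => θ₀) N (Φ N)
             let actw := fun (i : Fin (N + 1)) (z : Config (N + 1) (Fin 3) T3) =>
               σ / τ * (Φ N).collisionSum (Set.Ioc 0 w)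
                 (fun c => if c.fst = i then ‖c.postVel.1 - c.preVel.1‖ else 0) z
             let cntw := fun (i : Fin (N + 1)) (z : Config (N + 1) (Fin 3) T3) =>
               (Φ N).collisionSum (Set.Ioc 0 w) (fun c => if c.fst = i then (1 : ℝ) else 0) z
             let off := fun (i : Fin (N + 1)) (z : Config (N + 1) (Fin 3) T3) =>
               if actw i z ≤ V ∧ cntw i z ≤ V * τ then (0 : ℝ) else 1
             ∫⁻ z, ENNReal.ofReal (Real.exp (β * ∑ i : Fin (N + 1),
                 off i z * (1 + min (w⁻¹ * ∫ r in (0 : ℝ)..w, ‖((Φ N).flow r z i).2‖ ^ 2) Q))) ∂P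
               ≤ ENNReal.ofReal (Real.exp (ε * ((N : ℝ) + 1))))) →
    ∃ σ₀ : ℝ, 0 < σ₀ ∧ ∀ (a₀ θ₀ : ℝ) (u₀ : V3), 0 < a₀ → 0 < θ₀ → ∀ σ : ℝ, 0 < σ → σ < σ₀ →
          ∀ Φ : (N : ℕ) → HardSphereFlow (Torus.geometry (Fin 3)) (hsDiameter σ N) (N + 1),
          ∃ V₀ : ℝ, 0 < V₀ ∧ ∃ β₁ : ℝ, 0 < β₁ ∧ ∀ V : ℝ, V₀ ≤ V → ∀ β : ℝ, 0 < β → β ≤ β₁ →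
            ∀ ε : ℝ, 0 < ε → ∃ τ₀ : ℝ, 0 < τ₀ ∧ ∀ τ : ℝ, τ₀ ≤ τ →
              ∃ N₀ : ℕ, ∀ N : ℕ, N₀ ≤ N →
                (let w : ℝ := τ * ((N : ℝ) + 1) ^ (-(1 / 3 : ℝ))
                 let P := localGibbsLaw σ (fun _ => a₀) (fun _ => u₀) (fun _ => θ₀) N (Φ N)
                 let actw := fun (i : Fin (N + 1)) (z : Config (N + 1) (Fin 3) T3) =>
                   σ / τ * (Φ N).collisionSum (Set.Ioc 0 w)
                     (fun c => if c.fst = i then ‖c.postVel.1 - c.preVel.1‖ else 0) z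
                 let cntw := fun (i : Fin (N + 1)) (z : Config (N + 1) (Fin 3) T3) =>
                   (Φ N).collisionSum (Set.Ioc 0 w) (fun c => if c.fst = i then (1 : ℝ) else 0) z
                 let off := fun (i : Fin (N + 1)) (z : Config (N + 1) (Fin 3) T3) =>
                   if actw i z ≤ V ∧ cntw i z ≤ V * τ then (0 : ℝ) else 1
                 ∫⁻ z, ENNReal.ofReal (Real.exp (β * ∑ i : Fin (N + 1),
                     off i z * (1 + w⁻¹ * ∫ r in (0 : ℝ)..w, ‖((Φ N).flow r z i).2‖ ^ 2))) ∂P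
                   ≤ ENNReal.ofReal (Real.exp (ε * ((N : ℝ) + 1)))) := by
  rintro ⟨σ₀, hσ₀, hX⟩
  refine ⟨min σ₀ (1 / 2), lt_min hσ₀ (by norm_num), ?_⟩
  intro a₀ θ₀ u₀ ha hθ σ hσ hσlt Φ
  have hσ₀' : σ < σ₀ := hσlt.trans_le (min_le_left _ _)
  have hσ2 : σ ≤ 1 / 2 := (hσlt.trans_le (min_le_right _ _)).le
  obtain ⟨V₀, hV₀, β₁, hβ₁, hXV⟩ := hX a₀ θ₀ u₀ ha hθ σ hσ hσ₀' Φ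
  refine ⟨V₀, hV₀, min (β₁ / 2) (1 / (32 * θ₀)), lt_min (by positivity) (by positivity), ?_⟩
  intro V hV β hβ hββ₁ ε hε
  have hβ2 : 2 * β ≤ β₁ := by
    have := hββ₁.trans (min_le_left _ _)
    linarith
  have hβθ : 16 * β * θ₀ < 1 := by
    have h := hββ₁.trans (min_le_right _ _)
    rw [le_div_iff₀ (by positivity)] at h
    linarith
  -- the static constant and the truncation level
  set M : ℝ := Real.exp (8 * β * ‖u₀‖ ^ 2) * (1 - 16 * β * θ₀) ^ (-(3 : ℝ) / 2) with hM
  have hM0 : 0 < M := mul_pos (Real.exp_pos _) (Real.rpow_pos_of_pos (by linarith) _)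
  obtain ⟨Q, hQ0, hQ⟩ : ∃ Q : ℝ, 0 ≤ Q ∧ Real.exp (-(4 * β * Q)) * M ≤ ε / 2 := by
    refine ⟨max 0 (Real.log (2 * M / ε) / (4 * β)), le_max_left _ _, ?_⟩
    have h4β : 0 < 4 * β := by positivity
    have hlog : Real.log (2 * M / ε) ≤ 4 * β * max 0 (Real.log (2 * M / ε) / (4 * β)) := by
      have := le_max_right 0 (Real.log (2 * M / ε) / (4 * β))
      rw [div_le_iff₀ h4β] at this
      linarith
    have h1 : Real.exp (-(4 * β * max 0 (Real.log (2 * M / ε) / (4 * β)))) ≤ ε / (2 * M) := by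
      rw [← Real.exp_log (show 0 < ε / (2 * M) by positivity), Real.exp_le_exp, Real.log_div hε.ne'
        (by positivity), Real.log_mul two_ne_zero hM0.ne']
      have : Real.log (2 * M / ε) = Real.log 2 + Real.log M - Real.log ε := by
        rw [Real.log_div (by positivity) hε.ne', Real.log_mul two_ne_zero hM0.ne']
      linarith
    calc Real.exp (-(4 * β * max 0 (Real.log (2 * M / ε) / (4 * β)))) * M
        ≤ ε / (2 * M) * M := mul_le_mul_of_nonneg_right h1 hM0.le
      _ = ε / 2 := by field_simp
  -- the dynamical input at coupling `2β`, level `Q`, tolerance `ε/2`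
  obtain ⟨τ₀, hτ₀, hXτ⟩ := hXV V hV (2 * β) (by positivity) hβ2 Q hQ0 (ε / 2) (half_pos hε)
  refine ⟨τ₀, hτ₀, fun τ hτ => ?_⟩
  obtain ⟨N₀, hXN⟩ := hXτ τ hτ
  refine ⟨N₀, fun N hN => ?_⟩
  intro w P actw cntw off
  have hτpos : 0 < τ := hτ₀.trans_le hτ
  have hw : 0 < w := mul_pos hτpos (Real.rpow_pos_of_pos (by positivity) _)
  have ho0 : ∀ i z, 0 ≤ off i z := fun i z => by
    simp only [off]
    split_ifs <;> norm_num
  have ho1 : ∀ i z, off i z ≤ 1 := fun i z => by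
    simp only [off]
    split_ifs <;> norm_num
  -- the hypothesis at `N`
  have hA : ∫⁻ z, ENNReal.ofReal (Real.exp (2 * β * ∑ i : Fin (N + 1),
      off i z * (1 + min (w⁻¹ * ∫ r in (0 : ℝ)..w, ‖((Φ N).flow r z i).2‖ ^ 2) Q))) ∂P ≤
      ENNReal.ofReal (Real.exp (ε / 2 * ((N : ℝ) + 1))) := hXN N hN
  -- the static factor
  have hstat : ENNReal.ofReal ((1 + Real.exp (-(4 * β * Q)) * M) ^ (N + 1)) ≤
      ENNReal.ofReal (Real.exp (ε / 2 * ((N : ℝ) + 1))) := by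
    refine ENNReal.ofReal_le_ofReal ?_
    have h1 : 1 + Real.exp (-(4 * β * Q)) * M ≤ Real.exp (ε / 2) := by
      have := Real.add_one_le_exp (ε / 2)
      linarith
    have h0 : 0 ≤ 1 + Real.exp (-(4 * β * Q)) * M := by positivity
    calc (1 + Real.exp (-(4 * β * Q)) * M) ^ (N + 1) ≤ Real.exp (ε / 2) ^ (N + 1) :=
          pow_le_pow_left₀ h0 h1 _
      _ = Real.exp (ε / 2 * ((N : ℝ) + 1)) := by
          rw [← Real.exp_nat_mul]
          push_cast
          ring_nf
  have hT := d3_census_truncation a₀ θ₀ u₀ ha hθ σ hσ2 N (Φ N) off ho0 ho1 w β Q hw hβ.le hβθ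
  calc ∫⁻ z, ENNReal.ofReal (Real.exp (β * ∑ i : Fin (N + 1),
          off i z * (1 + w⁻¹ * ∫ r in (0 : ℝ)..w, ‖((Φ N).flow r z i).2‖ ^ 2))) ∂P
      ≤ 2⁻¹ * ∫⁻ z, ENNReal.ofReal (Real.exp (2 * β * ∑ i : Fin (N + 1),
          off i z * (1 + min (w⁻¹ * ∫ r in (0 : ℝ)..w, ‖((Φ N).flow r z i).2‖ ^ 2) Q))) ∂P +
        2⁻¹ * ENNReal.ofReal ((1 + Real.exp (-(4 * β * Q)) * M) ^ (N + 1)) := hT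
    _ ≤ 2⁻¹ * ENNReal.ofReal (Real.exp (ε / 2 * ((N : ℝ) + 1))) +
        2⁻¹ * ENNReal.ofReal (Real.exp (ε / 2 * ((N : ℝ) + 1))) := by
        gcongr
    _ = ENNReal.ofReal (Real.exp (ε / 2 * ((N : ℝ) + 1))) := by
        rw [← add_mul, ENNReal.inv_two_add_inv_two, one_mul]
    _ ≤ ENNReal.ofReal (Real.exp (ε * ((N : ℝ) + 1))) := by
        refine ENNReal.ofReal_le_ofReal (Real.exp_le_exp.2 ?_)
        nlinarith [hε, show (0 : ℝ) ≤ (N : ℝ) + 1 by positivity]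

end Summit.AtomisticToContinuum.HydrodynamicLimit.Theorems.ClampedCorrectorBirth

end
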